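import Literature.MathematicalPhysics.QuantumFieldTheory.Balaban1983to89.T4RelativeComb

/-!
# `Balaban1983to89.T4RelativeCombWindow` — the one-block relative comb gauge bound for NEAR-UNITARY pairs:
# the conjugation cost of the axial gauge in a (complex) window, made explicit and LOCAL TO THE BLOCK

CITATION HEADER (lean-in-tree rule 2026-08-18).  Kernel certificate, on CONCRETE `ℤ^d` carriers, of an ELEMENTARY
cell-side estimate wanted by the audit cell `pub-balaban` (T4-DAG v17 carved row `T4-O3.E-NE1′-OG1′-RESID°`, part (i)
"the complexified window Gᶜ with the conjugation cost of the comb gauge controlled"; record `t4/T4-EST-NE1p-P1.md`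
(O2): "the relative axial gauge of a NON-unitary (complexified) pair costs ‖u‖‖u⁻¹‖ per conjugation (T4AxialChain), so
the window room w − δ must absorb an e^{O(R·α₁)} factor — harmless iff R·α₁ = O(1) … unless the transverse gauge is
taken block-wise (M-cubes) and patched").  The PRINTED sentence whose unitary (𝔊-valued) case this generalises is the
interior-bond sentence of the proof of Lemma 1 of T. Bałaban, *Spaces of regular gauge field configurations on a
lattice and gauge fixing conditions*, Comm. Math. Phys. **99**, 75–102 (1985) [Balaban1985RegularSpaces] (cell paper
B8), p. 79, with the tree conventions of [3] = T. Bałaban, *Averaging operations for lattice gauge theories*, Comm.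
Math. Phys. **98**, 17–51 (1985) [Balaban1985Averaging] (cell paper B7), pp. 24–25.  The quotations below are COPIED
from the already certified citation headers of the tree modules `T4RelativeComb` (pv04 lineage, census C-pv04g13-1)
and `B8Lemma1Lattice` (b08 lineage, C-B8-33; renders named there); no new reading of a render is claimed.  They are
CONTEXT.  The papers are manuscripts UNDER ADJUDICATION by the cell; nothing of them is asserted here: the file
DEFINES a smallness class of unit-valued bond variables (`NearUnitary K`) and PROVES [folklore] facts about the
concrete comb gauge of `T4RelativeComb`; no printed claim enters as a hypothesis.

PRINTED STATUS OF THE CONTENT (the carved row asks "say which of (i)–(iii) is printed-type (LOCATION + page) and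
which is NEW").  Part (i) is NOT located in print by this seat: Lemma 1 of [Balaban1985RegularSpaces] is printed for
pairs `V₀, V′V₀` "satisfy[ing] the condition (1.7)" (𝔊-valued, i.e. unitary, configurations — quotation below), where
every conjugation is an isometry; the complexified configurations of [Balaban1989LargeFieldI] (cell paper B12, pp.
276–281) were NOT read by this seat.  The estimate below is therefore recorded as a NEW, CELL-SIDE, ELEMENTARY
([folklore]) statement about the cell's own model; whether a printed counterpart exists is a location question
passed to the literature seats (journal NOTE), not answered here.

PRINTED ([Balaban1985RegularSpaces] p. 79, Lemma 1, copied from C-B8-33): "Let V₀, V′V₀ satisfy the condition (1.7)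
for k = 1 and L arbitrary, and let (R(V₀)V′)(Γ_{y,x}) = 1 for x ∈ B(y), |\overline{V′V₀} − V̄₀| < α₁. (1.24) Then
|V′_b − 1| < 4d²α₀ + α₁ for arbitrary b. (1.25)"; (proof) "The conditions (R₀V′)(Γ_{y,x}) = 1, x ∈ B(y), imply V′_b = 1
for b ⊂ Γ_{y,x}. This and the above estimate imply |V′_b − 1| < (d − 1)(L − 1)2α₀L⁻² for b ⊂ B(y) by the same
reasoning as in [3] (between (44) and (46))."  PRINTED ([Balaban1985Averaging] pp. 24–25, copied from C-pv04g13-1):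
"V₀(Γ_{y,x}) = 1 imply V₀(x, x + e₁) = 1, |V₀(x, x + e₂) − 1| < |x₁ − y₁|α₀, …", "|V₀(Γ_{c,x}) − 1| ≦ Σ_{b⊂Γ_{c,x}}
|V₀,b − 1|".

READING — THE MODEL (the cell's, as in `T4RelativeComb`).  Bond variables are units `U x ν ∈ Rˣ` of a normed ring
(`T4RelativeComb.Cfg`); the printed "𝔊-valued" is `T4RelativeLadder.UnitaryLike` (`‖u‖ ≤ 1 ∧ ‖u⁻¹‖ ≤ 1`).  THIS FILE's
window class is `NearUnitary K u :↔ ‖u‖ ≤ K ∧ ‖u⁻¹‖ ≤ K` for a constant `K ≥ 1` (`K = 1` is `UnitaryLike`; for matrices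
`u = exp(iA)` with `A = A₁ + iA₂`, `A₁, A₂` Hermitian, one may take `K = e^{‖A₂‖}` — an illustration, not used).  The
relative comb (axial) gauge `g = combGauge U₀ U₁ z = hol₀⁻¹·hol₁` of the pair on the block `B(z)`, its tree bonds, the
based plaquettes `plaq`, the transverse defect `defect U₀ U₁ z x ν = (U₁^g)⟨x,x+e_ν⟩·U₀⟨x,x+e_ν⟩⁻¹` (= V′ bond-wise)
and the ladder length `ladderLen k ν = Σ_{ρ<ν} k_ρ ≤ (d−1)(L−1)` are those of `T4RelativeComb`, used BY NAME.

WHAT THE TREE ALREADY HAS.  `T4RelativeComb.interior_bound_crude` (pv04-g13): for UNITARY-LIKE pairs,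
`‖defect − 1‖ ≤ (d−1)(L−1)(q₁ + q₀)` on interior bonds of `B(z)` from the two sup curvature bounds — every conjugation an
isometry (`norm_conj_sub_one_eq`), one `norm_defect_rung_le` per ladder square.  `T4AxialChain.norm_conj_sub_one_le`
(pv04-g7): the general conjugation cost `‖uPu⁻¹ − 1‖ ≤ ‖u‖‖u⁻¹‖‖P − 1‖`.

WHAT THIS FILE ADDS (kernel-checked; new sibling leaf, imports `T4RelativeComb` BY NAME, nothing above is edited;
every declaration [folklore]):
 §1 `NearUnitary K` and its closure under `1`, inverse, product (constants multiply), monotonicity in `K`; the norm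
    inequalities of the route: `norm_conj_sub_one_le_of_nearUnitary` (cost `K·K`), `norm_mul_sub_one_le_telescope`
    (`‖PW − 1‖ ≤ ‖P − 1‖·‖W‖ + ‖W − 1‖` — the TELESCOPED step: the running word `W` is bounded ONCE by its length, never
    compounded), `norm_mul_inv_sub_one_le`.
 §2 NORM GROWTH ALONG TREES: `nearUnitary_hol` — `hol U z k` is `NearUnitary (K^{Σk})`; `hol_one` (the flat
    configuration has trivial holonomy); on the block `Σ k ≤ d(L−1)` (`sum_le_nat`), so every tree holonomy inside
    `B(z)` is `NearUnitary G`, `G = blockGaugeConst K d L = K^{d(L−1)}` (`nearUnitary_hol_block`), and the relative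
    comb gauge `g(z+k) = hol₀(k)⁻¹·hol₁(k)` is `NearUnitary (G·G)` there (`nearUnitary_combGauge_block`).
 §3 LASSO (Stokes) WORDS `lasso U z k ν = hol U z k · U⟨z+k, z+k+e_ν⟩ · (hol U z (k+e_ν))⁻¹` — the holonomy of the
    loop `z → z+k → z+k+e_ν → z` along the trees; `defect_one_eq_lasso` (it IS the flat-base defect of
    `T4RelativeComb`), `lasso_tree`, `lasso_rung` (from `T4RelativeComb.defect_rung` with `U₀ ≡ 1`: one conjugated plaquette per
    ladder square, conjugator = the tree holonomy `hol U z (pred' k)`), `nearUnitary_lasso` (`‖lasso‖, ‖lasso⁻¹‖ ≤ Λ =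
    lassoConst K d L = G·K·G` inside the block), and the WINDOW AXIAL COUNT `norm_lasso_sub_one_le`: if `‖plaq U − 1‖ ≤ q`
    on the squares of `B(z)` then `‖lasso U z k ν − 1‖ ≤ ladderLen k ν · (G·G·q·Λ)` — LINEAR in the ladder length, the
    conjugation cost `G·G` (per plaquette) and `Λ` (the running word) entering ONCE.
 §4 THE RELATIVE DEFECT THROUGH LASSOS: the identity `defect_eq_conj_lasso` — `defect U₀ U₁ z (z+k) ν =
    hol₀(k)⁻¹·(lasso₁ · lasso₀⁻¹)·hol₀(k)` (pure algebra) — and `interior_bound_window`: for NEAR-UNITARY `U₀, U₁`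
    (constant `K ≥ 1`) with sup curvature bounds `q₁, q₀ ≥ 0` on the squares of `B(z)`, every interior bond satisfies
        `‖defect U₀ U₁ z x ν − 1‖ ≤ windowCost K d L · (d−1)(L−1) · (q₁ + q₀)`,   `windowCost K d L = (G·G·Λ)·(G·G·Λ)`,
    i.e. `K` to the power `8d(L−1) + 2` (`windowCost_eq_pow`, `one_le_windowCost`) — the conjugation cost is a function of `(K, d, L)` ALONE (the block), not of
    the size of any ambient region: this is the typed content of "(i) block-wise the window cost is local";
    `windowCost_one` / `interior_bound_window_one`: at `K = 1` the bound IS the unitary count `(d−1)(L−1)(q₁+q₀)` of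
    `T4RelativeComb.interior_bound_crude` (same constant, independent proof route).
 §5 Dictionary / non-vacuity: `NearUnitary.of_unitaryLike`; the flat pair satisfies every hypothesis with
    `q₀ = q₁ = 0`; the class `NearUnitary 2` is strictly larger than `UnitaryLike` (the unit `2 ∈ ℝˣ`).

HONEST SCOPE.  (i) NOT located in print (see PRINTED STATUS): a cell-side elementary estimate; in particular NO claim
that [Balaban1989LargeFieldI] fixes axial gauges of complex configurations this way.  (ii) The exponent `8d(L−1)+2` is
what the lasso route gives; it is not optimised (the two conjugations by `hol₀(k)` and the two lasso norms could be
merged), only its LINEARITY in `d·L` and its independence of everything outside the block are the point.  (iii) ONE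
block, sup norms, the crude per-square input `q₁ + q₀` (no `plaqSup_fine`-type cross term, no Hölder / derivative norms
— part (ii) of the carved row is a regular-gauge matter, [Balaban1985RegularSpaces] Thm 2 / Prop. 3 / Thm 4, not treated
here), no crossing bonds / patching in the window (the unitary crossing-bond chain is `T4RelativeCombCrossing`; its
window version would multiply `crossConst` by powers of `K` in the same block-local way — NOT done here).  (iv) No
logarithms, no Lie-algebra smallness, no statement about any RT / window of the later papers.  Value = kernel
bookkeeping + located-gap narrowing; NOT summit progress.  Unit b2b-balaban-pv04 gen 14 (journal claim
T4-O3.E-NE1′-OG1′-WINDOW*).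

v1.1 (APPEND-ONLY; same unit and generation; nothing of v1 removed or reworded) ADDITIONS — §6 THE WINDOW DICTIONARY:
`NearUnitary.of_norm_sub_one_le` (a unit within `t < 1` of `1` is `(1 − t)⁻¹`-near-unitary — a-priori Neumann bound,
no completeness), `NearUnitary.window` / `window'` (a product `w·v` of such a `w` and a unitary-like `v` is
`(1 − t)⁻¹`-near-unitary: the complexified window around the 𝔊-valued configurations, elementarily),
`windowCost_le_exp` (scalar step `(1 − t)⁻¹ ≤ e^{2t}`, `0 ≤ t ≤ 1/2`, = the tree's
`Literature.NumberTheory.Automorphic.inv_one_sub_le_exp_two_mul`, inlined to keep the imports inside the Bałaban package; (`windowCost (1−t)⁻¹ d L ≤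
exp((8d(L−1)+2)·2t)`) and `interior_bound_window_exp` (the interior bound with the constant `e^{(8d(L−1)+2)·2t}` — the
typed form of the record's "e^{O(R·α)} factor" with `R` = ONE BLOCK), and `nearUnitary_gaugeAct` /
`nearUnitary_gaugeAct_of_unitaryLike` (a `G`-near-unitary gauge transformation maps `K`-near-unitary configurations to
`G·K·G`-near-unitary ones; `G = 1` for 𝔊-valued ones — the window class is stable under the printed action (1.10) quoted
below).  Same HONEST SCOPE; [folklore] throughout.  (Cross-read of v1, GAPS C-pv15g8-2, remark R3, acknowledged:
`interior_bound_window` / `_window_one` ask `0 ≤ q₁` and `0 ≤ q₀` separately where `T4RelativeComb.interior_bound_crude`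
needs only `0 ≤ q₁ + q₀` — each is used for its own configuration's lasso bound `norm_lasso_sub_one_le`; immaterial for
consumers, curvature sup bounds being nonnegative.)

v1.2 (APPEND-ONLY; same unit and generation) ADDITIONS — §7 THE FACTORISED RESPONSE.  The audit cell's literature seat
LOCATED the printed mechanism for complexified configurations (GAPS A-t4lit1-3 with UPDATES A-t4lit1-3a / A-t4lit1-3b;
v1.4 UPDATE PARAGRAPH below): ONE complexified configuration IS put in a generalized axial gauge by a Gᶜ-valued `v`, first
order ([Balaban1987RG1] (3.26) p. 275, READING (b) below), and a complex perturbation `V′V₀` of a regular unitary `V₀` IS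
taken as the reference of the relative block axial gauges at an explicit price ([Balaban1985Averaging] p. 43, v1.4
paragraph); complexified configurations are FACTORISED `𝐔 = U′U` ((1.11)–(1.13) p. 262, quoted below), the factor `U′`
near `1` carried with LINEAR, first-order bounds (v1.3 = this sentence and one docstring of §7 RE-WORDED, comment-only:
XREAD D1 of GAPS C-pv06g14-4; v1.4 = the same sentence and docstring RE-WORDED again, comment-only, per GAPS A-t4lit1-3b,
which WITHDRAWS the located-absence clause «print has NO RELATIVE gauge fixing of a non-unitary PAIR» of A-t4lit1-3a
that v1.2/v1.3 quoted).  §7 types that mechanism on the carriers of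
`T4RelativeComb`, as cell-side [folklore] with explicit constants (nothing printed enters a declaration): for factorised
pairs `𝐔ᵢ = Wᵢ ⊙ Uᵢ` (`fmul`, bondwise product; `Uᵢ` unitary-like, `Wᵢ` arbitrary units — the factorisation is DATA) and
the comb gauge `g = combGauge U₀ U₁ z` OF THE UNITARY PARTS (unitary-like: NO conjugation cost), the exact identity
`(𝐔₁^g)(b)·𝐔₀(b)⁻¹ = (g_x·W₁(b)·g_x⁻¹)·[(U₁^g)(b)·U₀(b)⁻¹]·W₀(b)⁻¹` (`factorised_response`, any `g`;
`factorised_response_comb`) and the LINEAR bound `‖(𝐔₁^g)(b)·𝐔₀(b)⁻¹ − 1‖ ≤ M·(n₁·δ + w + 2·γ·t₀)`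
(`norm_factorised_sub_one_le`, `factorised_bound`; `δ ≥ ‖defect(b) − 1‖` the unitary relative transverse defect of
`T4RelativeComb`, `γ ≥ ‖g_x − 1‖` (= `d(L−1)ε` by `T4RelativeComb.norm_combGauge_sub_one_le`), `n₁ ≥ ‖W₁(b)‖`,
`w ≥ ‖W₁(b) − W₀(b)‖`, `t₀ ≥ ‖W₀(b) − 1‖`, `M ≥ ‖W₀(b)⁻¹‖`, e.g. `M = (1 − t₀)⁻¹` by §6) — the only term beyond the
unitary defect and the complex factors' own relative deviation is the SECOND-ORDER commutator `2γt₀`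
(`T4RelativeLadder.norm_conj_sub_le`: the factor of `1` is rotated by `g_x`, that of `0` is not); packaged with the
fine / crude unitary interior bounds as `factorised_interior_bound_fine` (`M·(n₁(d−1)(L−1)(p + 2d(L−1)εq) + w +
2d(L−1)ε·t₀)`) / `factorised_interior_bound_crude` (no relative transport smallness: commutator term `4t₀`, first
order — the honest price), on TREE bonds `factorised_tree_bound` (`M·(w + 2γt₀)`: the complex factors' relative deviation
is NOT gauged away; in print `U′` is handled by analyticity of the densities, not by gauge fixing), and with absolute
window data only `factorised_bound_abs` (`(1 − t₀)⁻¹·((1 + t₁)δ + (t₁ + t₀) + 2γt₀)`, versus §4's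
`windowCost·(d−1)(L−1)(q₁ + q₀)`: for pairs PRESENTED FACTORISED the exponential cost in `d(L−1)` is absent).
CONSEQUENCE for consumers: in the printed factorised presentation the gauge is unitary-like, so transport statements that
need only 𝔊-valued gauge invariance apply, with no `windowCost` factor; §1–§5 remain the statement for UNFACTORISED
near-unitary pairs.  HONEST SCOPE of §7: sup norms, one block, interior and tree bonds only; the curvature / deviation
hypotheses are on the 𝔊-valued parts (printed analogue: (1.11), CONTEXT) and the complex factors enter only through
`‖W − 1‖`, `‖W₁ − W₀‖`, `‖W⁻¹‖` (no exponential map: `‖U′ − 1‖ ≤ t`, not `|A′| < α₁`; no (1.14)-type curvature of the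
full `𝐔` is used or produced); [folklore]; NOT summit progress.
v1.4 UPDATE PARAGRAPH (2026-08-19, comment-only; every declaration byte-identical to v1.3 p185568).  WHERE THE WINDOW
MECHANISM SITS IN PRINT, per the literature seat's located record GAPS A-t4lit1-3b (inside the series) and A-t4lit16-1 /
-2 (outside): INSIDE — printed-type at [Balaban1985Averaging] (T. Bałaban, CMP **98** (1985) 17–51) p. 43, the paragraph
before Proposition 7, render `b2b-balaban-ref1/pages/1985-cmp98-averaging/1985-cmp98-averaging-p027-x2.png` READ AS AN
IMAGE by this seat, CONTEXT ONLY: «Let us analyze the proof of Proposition 3 first. The bounds depend on bounds of the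
quantities Y_x = (1/i) log V₀(Γ_{c,x}∪(−c)). Previously we had |Y_x| = O(L²α₀), but now we allow complex perturbations
V′V₀ of V₀, and for these we have |Y_x| = O(L²α₀ + Lα₁). Thus Proposition 3 holds unifirmly for V′V₀ instead of V₀ and
with the only change in the inequality (126), where the constant e^{O(1)L²α₀} on the right-hand side is replaced by
e^{O(1)(L²α₀+Lα₁)}.» … «Because of the bound (164), we have to replace the factors e^{O(1)L^{2(j+1)}η²α₀} by
e^{O(1)(L^{2(j+1)}η²α₀+L^{j+1}ηα₁)}, but this change is easily incorporated into the considerations and the estimates.»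
(asserted, O(1) implicit; ONE complex perturbation `V′ = e^{iηA′}`, `|A′| < α₁`, of a (52)-regular unitary reference —
a conjugation price growing with (comb length) × (non-unitarity), i.e. the MECHANISM of `windowCost` in printed type);
the unitary crossing ancestor is [Balaban1985RegularSpaces] Lemma 1 pp. 79–80 (header of `T4RelativeCombCrossing`).
OUTSIDE the series — SHAPE / precedent only (A-t4lit16-1 / -2).  THE CELL'S OWN, with no located printed counterpart: the
general invertible two-sided window formulation (`NearUnitary K`, `K`-near-unitary gauges), the explicit exponent
`8d(L−1)+2` and constants, and the non-unitary TWO-configuration crossing / patching.  Nothing of this paragraph enters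
a declaration.

ERRATUM (v1.1) to two v1 sentences, left in place above/below: «the complexified configurations of
[Balaban1989LargeFieldI] (cell paper B12, pp. 276–281) were NOT read by this seat» (PRINTED STATUS) and «NO claim that
[Balaban1989LargeFieldI] fixes axial gauges of complex configurations this way» (HONEST SCOPE (i)) carry the WRONG BIB
KEY: the cell's paper B12 is [Balaban1987RG1] (CMP 109 (1987) 249–301), and that is the paper meant (its pp. 262–263 and
275–276 are the complex-window pages); [Balaban1989LargeFieldI] is cell paper B15 (CMP 122 (1989) 175–202) and was
never meant.  Read «[Balaban1987RG1]» at both places.  (Pointed out independently by the cross-read of v1, GAPS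
C-pv15g8-2, finding D1.)  MOREOVER the v1 sentence «NOT located in print / unread» is now SUPERSEDED: during this
generation the seat READ, as images, the renders `HOME/b2b-balaban-ref1/pages/1987-cmp109-rg-I-small-field/1987-cmp109-
rg-I-small-field-p014-x2.png` (p. 262), `…-p015-x2.png` (p. 263) and `…-p027-x2.png` (p. 275) (reading recorded as GAPS
C-pv04g14-3 / C-pv04g14-4); the quotations below come from that reading and are CONTEXT ONLY — nothing printed enters
any declaration of this file.
PRINTED ([Balaban1987RG1] p. 262): "The gauge field configuration 𝐔 is defined at bonds of X and has values in Gᶜ,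
the configuration 𝐉 is also defined at bonds of X and has values in 𝔤ᶜ. A Gᶜ-valued gauge transformation u acts on
pairs (𝐔, 𝐉) in the following way (𝐔, 𝐉)^u = (𝐔^u, R(u)𝐉) = (u₋𝐔u₊⁻¹, R(u₋)𝐉), (1.10)"; "The space
U^c_j(X, α₀, α₁, γ₀) is a union of orbits [(𝐔, 𝐉)] determined by configurations 𝐔, 𝐉 satisfying the four conditions
written below. (i) 𝐔 = U′U, U has values in the group G, |∂U − 1| < α₀ξ² on X, (1.11) for each cube □ ⊂ X of a size
O(1)LM there exists a G-valued gauge transformation u defined on □ and such, that U^u = exp iξA, |A|, |∇^ξA| <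
O(1)LMBα₀ on □, (1.12) with a sufficiently large constant B (it will be determined later). (ii) U′ = exp iξA′, A′ has
values in the algebra 𝔤ᶜ, |A′|, |∇^ξ_U A′| < α₁ on X. (1.13) (iii) The configurations 𝐔, 𝐉 satisfy the bounds
|∂𝐔 − 1| < α₀ξ², |𝐉| < γ₀ on X. (1.14) (iv) We consider X as Ω₀, and we construct the sequence {Ω_n}, n = 1, …, j, of
maximal possible domains satisfying the conditions (1.3)–(1.6) [14] (with j, ξ instead of k, η, R = R₁). For this
sequence, or rather for its subsequences {Ω₀, Ω₁, …, Ω_n}, n = 1, …, j, we construct the functions U_n(V) in the axial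
gauges, for regular Gᶜ-valued configurations V."  PRINTED (ibid. p. 263): "for all Gᶜ-valued gauge transformations u.
The spaces U^c_j(X, α₀, α₁) are, by the definition, gauge invariant also."  PRINTED (ibid. p. 275): "We repeat the
constructions of Sect. F [15], and we introduce the same generalized axial gauge for the configuration M˙(𝐔). This is
achieved by a gauge transformation v, and we have M˙(𝐔) = V^v, |V(b) − 1| < O(1)Mα₀, |v − 1| < O(1)Mα₁. (3.26)" and
"We assume that α₀, α₁ are chosen so that Mα₀, Mα₁ are still small."
READING (what this locates and what it does not).  (a) The printed complex window IS a product «near-1 factor U′» ×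
«G-valued factor U» (p. 262 (i)/(ii)) — the shape of §6's `NearUnitary.window` below (`w` = U′ with `‖U′ − 1‖ ≤ t`,
`v` = U unitary-like; the passage from the printed `|A′| < α₁` to a norm bound on `exp iξA′ − 1` is NOT typed here — no
exponential map in this file), and the class is acted on by Gᶜ-valued gauge transformations ((1.10); `nearUnitary_gaugeAct`
below).  (b) Axial gauges of Gᶜ-valued configurations ARE used in print (p. 262 (iv)), and p. 275 (3.26) PRINTS — as an
assertion, its construction deferred to "Sect. F [15]" of that paper's reference list (unread here) — the SHAPE of part
(i) of the carved row for ONE configuration on an M-cube in Bałaban's metric: the gauge-fixed bond variables deviate from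
1 by «O(1)Mα₀» (curvature constant × cube side: the relative of the interior bounds `interior_bound_crude` / `_window`,
whose `(d−1)(L−1)·q` is linear in the block side) and the gauge transformation deviates from 1 by «O(1)Mα₁» (complex-part
constant × cube side: the relative of `nearUnitary_hol_block`, `G = K^{d(L−1)}`, i.e. `e^{d(L−1)·a}` for `K = e^{a}`).
(c) What is NOT printed on these pages, and is the content of this file: a RELATIVE statement (a PAIR `U₀, U₁`, the comb
gauge fixing one to the other), in a general normed ring, with EXPLICIT block-local constants and a kernel proof.  So
v1's classification is SHARPENED, not reversed: part (i) is printed-TYPE (location [Balaban1987RG1] p. 275 (3.26), with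
p. 262 (i)–(iv) for the class), asserted there without proof; the ESTIMATES of this file are the cell-side [folklore]
version with explicit constants; nothing printed is used.
-/

namespace Literature.MathematicalPhysics.QuantumFieldTheory.Balaban1983to89.T4RelativeCombWindow

open Finset
open B8Lemma1Lattice (e site site_add_single InBlock inBlock_site_iff exists_offset_of_inBlock lt_of_add_single)
open T4RelativeLadder (UnitaryLike)
open T4RelativeComb (Cfg gaugeAct plaq plaq_gaugeAct IsTree low pred' pred'_le pred'_add_single pred'_apply_of_ne
  isTree_pred' sum_eq_sum_pred'_succ low_le hol hol_zero hol_succ relGauge combGauge combGauge_site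
  gaugeAct_combGauge_tree defect defect_tree defect_rung ladderLen ladderLen_eq_succ ladderLen_le
  isTree_of_ladderLen_eq_zero PlaqSup)

variable {R : Type*} [NormedRing R] {d : ℕ}

/-- [folklore] Local name for the site type `ℤ^d` (= `T4RelativeComb.Site d`). -/
abbrev Site (d : ℕ) := Fin d → ℤ

example (d : ℕ) : Site d = T4RelativeComb.Site d := rfl

/-! ## §1  Near-unitary units and the norm inequalities of the route -/

/-- [folklore] THE WINDOW CLASS: a unit `u` is `K`-near-unitary if `‖u‖ ≤ K` and `‖u⁻¹‖ ≤ K`.  `K = 1` is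
`T4RelativeLadder.UnitaryLike` ("𝔊-valued"); `K > 1` admits non-unitary (complexified) bond variables, every conjugation
by `u` then costing at most `K·K` (`norm_conj_sub_one_le_of_nearUnitary`). -/
def NearUnitary (K : ℝ) (u : Rˣ) : Prop := ‖(u : R)‖ ≤ K ∧ ‖((u⁻¹ : Rˣ) : R)‖ ≤ K

namespace NearUnitary

/-- [folklore] Dictionary: unitary-like units are `K`-near-unitary for every `K ≥ 1`. -/
theorem of_unitaryLike {u : Rˣ} (h : UnitaryLike u) {K : ℝ} (hK : 1 ≤ K) : NearUnitary K u :=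
  ⟨h.1.trans hK, h.2.trans hK⟩

/-- [folklore] At `K = 1` the window class is exactly the unitary-like class. -/
theorem iff_unitaryLike (u : Rˣ) : NearUnitary 1 u ↔ UnitaryLike u := Iff.rfl

/-- [folklore] `1` is `K`-near-unitary for `K ≥ 1`. -/
theorem one [NormOneClass R] {K : ℝ} (hK : 1 ≤ K) : NearUnitary K (1 : Rˣ) :=
  ⟨by simpa using hK, by simpa using hK⟩

/-- [folklore] The class is closed under inversion. -/
theorem inv {K : ℝ} {u : Rˣ} (h : NearUnitary K u) : NearUnitary K u⁻¹ :=
  ⟨h.2, by rw [inv_inv]; exact h.1⟩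

/-- [folklore] The constant is nonnegative. -/
theorem nonneg {K : ℝ} {u : Rˣ} (h : NearUnitary K u) : 0 ≤ K := (norm_nonneg _).trans h.1

/-- [folklore] Products: constants multiply (`‖uv‖ ≤ ‖u‖‖v‖`, `‖(uv)⁻¹‖ = ‖v⁻¹u⁻¹‖ ≤ ‖v⁻¹‖‖u⁻¹‖`). -/
theorem mul {K₁ K₂ : ℝ} {u v : Rˣ} (hu : NearUnitary K₁ u) (hv : NearUnitary K₂ v) :
    NearUnitary (K₁ * K₂) (u * v) := by
  refine ⟨?_, ?_⟩
  · rw [Units.val_mul]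
    exact (norm_mul_le _ _).trans (mul_le_mul hu.1 hv.1 (norm_nonneg _) hu.nonneg)
  · rw [mul_inv_rev, Units.val_mul]
    calc _ ≤ ‖((v⁻¹ : Rˣ) : R)‖ * ‖((u⁻¹ : Rˣ) : R)‖ := norm_mul_le _ _
      _ ≤ K₂ * K₁ := mul_le_mul hv.2 hu.2 (norm_nonneg _) hv.nonneg
      _ = K₁ * K₂ := mul_comm _ _

/-- [folklore] Monotonicity in the constant. -/
theorem mono {K K' : ℝ} {u : Rˣ} (h : NearUnitary K u) (hKK' : K ≤ K') : NearUnitary K' u :=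
  ⟨h.1.trans hKK', h.2.trans hKK'⟩

end NearUnitary

/-- [folklore] THE CONJUGATION COST in the window: `‖u·P·u⁻¹ − 1‖ ≤ K·K·‖P − 1‖` for `K`-near-unitary `u`
(`T4AxialChain.norm_conj_sub_one_le` with the two norms bounded; `= ‖P − 1‖` at `K = 1`). -/
theorem norm_conj_sub_one_le_of_nearUnitary {K : ℝ} {u : Rˣ} (hu : NearUnitary K u) (P : R) :
    ‖(u : R) * P * ↑u⁻¹ - 1‖ ≤ K * K * ‖P - 1‖ :=
  (T4AxialChain.norm_conj_sub_one_le u P).trans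
    (mul_le_mul_of_nonneg_right (mul_le_mul hu.1 hu.2 (norm_nonneg _) hu.nonneg) (norm_nonneg _))

/-- [folklore] The same with the conjugator inverted: `‖u⁻¹·P·u − 1‖ ≤ K·K·‖P − 1‖`. -/
theorem norm_inv_conj_sub_one_le_of_nearUnitary {K : ℝ} {u : Rˣ} (hu : NearUnitary K u) (P : R) :
    ‖((u⁻¹ : Rˣ) : R) * P * ↑u - 1‖ ≤ K * K * ‖P - 1‖ := by
  have := norm_conj_sub_one_le_of_nearUnitary hu.inv P
  rwa [inv_inv] at this

/-- [folklore] THE TELESCOPED STEP: `‖P·W − 1‖ ≤ ‖P − 1‖·‖W‖ + ‖W − 1‖` (`PW − 1 = (P − 1)W + (W − 1)`) — the running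
word `W` enters through its norm ONCE; nothing is compounded along a ladder. -/
theorem norm_mul_sub_one_le_telescope (P W : R) : ‖P * W - 1‖ ≤ ‖P - 1‖ * ‖W‖ + ‖W - 1‖ := by
  have h : P * W - 1 = (P - 1) * W + (W - 1) := by noncomm_ring
  rw [h]
  exact (norm_add_le _ _).trans (add_le_add (norm_mul_le _ _) le_rfl)

/-- [folklore] `‖X·Y⁻¹ − 1‖ ≤ (‖X − 1‖ + ‖Y − 1‖)·‖Y⁻¹‖` (`XY⁻¹ − 1 = ((X − 1) − (Y − 1))·Y⁻¹`). -/
theorem norm_mul_inv_sub_one_le (X : R) (Y : Rˣ) :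
    ‖X * ↑Y⁻¹ - 1‖ ≤ (‖X - 1‖ + ‖(Y : R) - 1‖) * ‖((Y⁻¹ : Rˣ) : R)‖ := by
  have h : X * ↑Y⁻¹ - 1 = ((X - 1) - ((Y : R) - 1)) * ↑Y⁻¹ := by
    rw [sub_sub_sub_cancel_right, sub_mul, Units.mul_inv]
  rw [h]
  exact (norm_mul_le _ _).trans (mul_le_mul_of_nonneg_right (norm_sub_le _ _) (norm_nonneg _))

/-! ## §2  Norm growth along the staircase trees -/

/-- [folklore] The flat configuration has trivial tree holonomies: `hol 1 z k = 1`. -/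
theorem hol_one (z : Site d) : ∀ k : Fin d → ℕ, hol (fun _ _ => (1 : Rˣ)) z k = 1 := by
  suffices H : ∀ n (k : Fin d → ℕ), ∑ ρ, k ρ = n → hol (fun _ _ => (1 : Rˣ)) z k = 1 from fun k => H _ k rfl
  intro n
  induction n with
  | zero =>
      intro k hk
      have hk0 : k = 0 := by
        funext κ; exact (Finset.sum_eq_zero_iff.1 hk) κ (mem_univ κ)
      subst hk0; exact hol_zero _ z
  | succ n ih =>
      intro k hk
      obtain ⟨ρ₁, -, hρ₁⟩ : ∃ ρ ∈ (univ : Finset (Fin d)), k ρ ≠ 0 :=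
        Finset.exists_ne_zero_of_sum_ne_zero (by omega)
      have h : ∃ ρ, k ρ ≠ 0 := ⟨ρ₁, hρ₁⟩
      have hn : ∑ ρ, pred' k h ρ = n := by have := sum_eq_sum_pred'_succ k h; omega
      have e1 : hol (fun _ _ => (1 : Rˣ)) z k =
          hol (fun _ _ => (1 : Rˣ)) z (pred' k h) * (fun _ _ => (1 : Rˣ)) (site z (pred' k h)) (low k h) := by
        conv_lhs => rw [← pred'_add_single k h]
        exact hol_succ _ z (isTree_pred' k h)
      rw [e1, ih _ hn, one_mul]

/-- [folklore] NORM GROWTH ALONG A TREE: for a `K`-near-unitary configuration the holonomy `U(Γ_{z,z+k})` of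
the `|k|₁ = Σ_ρ k_ρ` tree bonds is `K^{|k|₁}`-near-unitary — one factor `K` per bond (the multiplicative form of
"|V₀(Γ_{c,x}) − 1| ≦ Σ_{b⊂Γ_{c,x}} |V₀,b − 1|"). -/
theorem nearUnitary_hol [NormOneClass R] {K : ℝ} {U : Cfg d R} (hU : ∀ x ν, NearUnitary K (U x ν))
    (z : Site d) : ∀ k : Fin d → ℕ, NearUnitary (K ^ (∑ ρ, k ρ)) (hol U z k) := by
  suffices H : ∀ n (k : Fin d → ℕ), ∑ ρ, k ρ = n → NearUnitary (K ^ n) (hol U z k) from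
    fun k => H _ k rfl
  intro n
  induction n with
  | zero =>
      intro k hk
      have hk0 : k = 0 := by
        funext κ; exact (Finset.sum_eq_zero_iff.1 hk) κ (mem_univ κ)
      subst hk0; rw [hol_zero, pow_zero]; exact NearUnitary.one le_rfl
  | succ n ih =>
      intro k hk
      obtain ⟨ρ₁, -, hρ₁⟩ : ∃ ρ ∈ (univ : Finset (Fin d)), k ρ ≠ 0 :=
        Finset.exists_ne_zero_of_sum_ne_zero (by omega)
      have h : ∃ ρ, k ρ ≠ 0 := ⟨ρ₁, hρ₁⟩
      have hn : ∑ ρ, pred' k h ρ = n := by have := sum_eq_sum_pred'_succ k h; omega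
      have e1 : hol U z k = hol U z (pred' k h) * U (site z (pred' k h)) (low k h) := by
        conv_lhs => rw [← pred'_add_single k h]
        exact hol_succ U z (isTree_pred' k h)
      rw [e1, pow_succ]
      exact (ih _ hn).mul (hU _ _)

/-- [folklore] Inside the block the tree length is at most `d(L−1)`: `Σ_ρ k_ρ ≤ d(L−1)` for `k < L` coordinatewise
(the `ℕ`-valued form of `T4RelativeComb.sum_le`). -/
theorem sum_le_nat {L : ℕ} {k : Fin d → ℕ} (hk : ∀ κ, k κ < L) : ∑ ρ, k ρ ≤ d * (L - 1) := by
  have := Finset.sum_le_card_nsmul (univ : Finset (Fin d)) k (L - 1) (fun ρ _ => by have := hk ρ; omega)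
  simpa using this

/-- [folklore] THE BLOCK GAUGE CONSTANT `G = K^{d(L−1)}`: the bound on every tree holonomy inside `B(z)`. -/
def blockGaugeConst (K : ℝ) (d L : ℕ) : ℝ := K ^ (d * (L - 1))

/-- [folklore] `G ≥ 1` for `K ≥ 1`. -/
theorem one_le_blockGaugeConst {K : ℝ} (hK : 1 ≤ K) (d L : ℕ) : 1 ≤ blockGaugeConst K d L :=
  one_le_pow₀ hK

/-- [folklore] Every tree holonomy inside the block is `G`-near-unitary. -/
theorem nearUnitary_hol_block [NormOneClass R] {K : ℝ} (hK : 1 ≤ K) {U : Cfg d R}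
    (hU : ∀ x ν, NearUnitary K (U x ν)) (z : Site d) {L : ℕ} {k : Fin d → ℕ} (hk : ∀ κ, k κ < L) :
    NearUnitary (blockGaugeConst K d L) (hol U z k) :=
  (nearUnitary_hol hU z k).mono (pow_le_pow_right₀ hK (sum_le_nat hk))

/-- [folklore] The relative comb gauge `g(z+k) = hol₀(k)⁻¹·hol₁(k)` inside the block is `G·G`-near-unitary — the
transport cost of the comb gauge is a function of `(K, d, L)` only. -/
theorem nearUnitary_combGauge_block [NormOneClass R] {K : ℝ} (hK : 1 ≤ K) {U₀ U₁ : Cfg d R}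
    (hU₀ : ∀ x ν, NearUnitary K (U₀ x ν)) (hU₁ : ∀ x ν, NearUnitary K (U₁ x ν)) (z : Site d) {L : ℕ}
    {k : Fin d → ℕ} (hk : ∀ κ, k κ < L) :
    NearUnitary (blockGaugeConst K d L * blockGaugeConst K d L) (combGauge U₀ U₁ z (site z k)) := by
  rw [combGauge_site]
  exact (nearUnitary_hol_block hK hU₀ z hk).inv.mul (nearUnitary_hol_block hK hU₁ z hk)

/-! ## §3  Lasso (Stokes) words and the window axial count -/

/-- [folklore] THE LASSO WORD of the bond `⟨z+k, z+k+e_ν⟩`: along the tree to `z+k`, across the bond, back along the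
tree from `z+k+e_ν` — `U(Γ_{z,z+k})·U⟨z+k,z+k+e_ν⟩·U(Γ_{z,z+k+e_ν})⁻¹`.  For a tree bond it is `1`; in general it is the
ordered product of the plaquettes of the ladder under the bond (`lasso_rung`). -/
def lasso (U : Cfg d R) (z : Site d) (k : Fin d → ℕ) (ν : Fin d) : Rˣ :=
  hol U z k * U (site z k) ν * (hol U z (k + Pi.single ν 1))⁻¹

/-- [folklore] The lasso word IS the flat-base defect of `T4RelativeComb`: `defect 1 U z (z+k) ν = lasso U z k ν`
(the comb gauge relative to the flat configuration is the axial gauge `hol U`). -/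
theorem defect_one_eq_lasso (U : Cfg d R) (z : Site d) (k : Fin d → ℕ) (ν : Fin d) :
    defect (fun _ _ => 1) U z (site z k) ν = lasso U z k ν := by
  simp only [defect, gaugeAct, lasso, combGauge_site, relGauge, hol_one, inv_one, one_mul, mul_one,
    ← site_add_single]

/-- [folklore] Lasso words of tree bonds are trivial. -/
theorem lasso_tree (U : Cfg d R) (z : Site d) {k : Fin d → ℕ} {ν : Fin d} (hk : IsTree k ν) :
    lasso U z k ν = 1 := by
  rw [← defect_one_eq_lasso, defect_tree _ U z hk]

/-- [folklore] THE LASSO RUNG (Stokes, one square): for `k ≠ 0` with `ρ₀ = low k < ν` and `y = z + pred' k`,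
`lasso(k, ν) = [hol U z (pred' k) · plaq U (y; ρ₀, ν) · (hol U z (pred' k))⁻¹] · lasso(pred' k, ν)` — one plaquette,
conjugated by the tree holonomy to its base point (`T4RelativeComb.defect_rung` with `U₀ ≡ 1` and `plaq_gaugeAct`). -/
theorem lasso_rung (U : Cfg d R) (z : Site d) (k : Fin d → ℕ) (h : ∃ ρ, k ρ ≠ 0) (ν : Fin d)
    (hν : ((low k h : Fin d) : ℕ) < ν) :
    lasso U z k ν =
      (hol U z (pred' k h) * plaq U (site z (pred' k h)) (low k h) ν * (hol U z (pred' k h))⁻¹) *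
        lasso U z (pred' k h) ν := by
  have hr := defect_rung (fun _ _ => (1 : Rˣ)) U z k h ν hν
  rw [defect_one_eq_lasso, defect_one_eq_lasso, plaq_gaugeAct, combGauge_site] at hr
  rw [hr]
  simp only [relGauge, hol_one, inv_one, one_mul, mul_one, plaq]

/-- [folklore] THE LASSO CONSTANT `Λ = G·K·G`: the bound on every lasso word (and its inverse) inside the block. -/
def lassoConst (K : ℝ) (d L : ℕ) : ℝ := blockGaugeConst K d L * K * blockGaugeConst K d L

/-- [folklore] `Λ ≥ 1` for `K ≥ 1`. -/
theorem one_le_lassoConst {K : ℝ} (hK : 1 ≤ K) (d L : ℕ) : 1 ≤ lassoConst K d L := by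
  have hG := one_le_blockGaugeConst hK d L
  exact one_le_mul_of_one_le_of_one_le (one_le_mul_of_one_le_of_one_le hG hK) hG

/-- [folklore] Lasso words of bonds with both ends in the block are `Λ`-near-unitary (`‖lasso‖, ‖lasso⁻¹‖ ≤ G·K·G`). -/
theorem nearUnitary_lasso [NormOneClass R] {K : ℝ} (hK : 1 ≤ K) {U : Cfg d R}
    (hU : ∀ x ν, NearUnitary K (U x ν)) (z : Site d) {L : ℕ} {k : Fin d → ℕ} (hk : ∀ κ, k κ < L) {ν : Fin d}
    (hν : k ν + 1 < L) : NearUnitary (lassoConst K d L) (lasso U z k ν) := by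
  have hk' : ∀ κ, (k + Pi.single ν 1 : Fin d → ℕ) κ < L := lt_of_add_single hk hν
  exact ((nearUnitary_hol_block hK hU z hk).mul (hU _ _)).mul (nearUnitary_hol_block hK hU z hk').inv

/-- [folklore] THE WINDOW AXIAL COUNT (flat base, near-unitary configuration): if `‖plaq U (y) − 1‖ ≤ q` on the squares
of `B(z)` then every bond `⟨z+k, z+k+e_ν⟩` with both ends in `B(z)` has
`‖lasso U z k ν − 1‖ ≤ ladderLen k ν · (G·G·q·Λ)` — induction on the ladder length with the TELESCOPED step
`‖PW − 1‖ ≤ ‖P − 1‖·‖W‖ + ‖W − 1‖`: per square the conjugated plaquette costs `G·G·q` (`norm_conj_sub_one_le_of_nearUnitary`)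
times the norm `Λ` of the running lasso (`nearUnitary_lasso`), and NOTHING compounds.  At `K = 1` this is the printed
axial sentence's count `ladderLen · q` (`T4RelativeComb.axial_bound`). -/
theorem norm_lasso_sub_one_le [NormOneClass R] {K : ℝ} (hK : 1 ≤ K) {U : Cfg d R} {z : Site d} {L : ℕ} {q : ℝ}
    (hU : ∀ x ν, NearUnitary K (U x ν)) (hq : PlaqSup L z (fun y ρ ν => ‖(plaq U y ρ ν : R) - 1‖) q)
    (hq0 : 0 ≤ q) :
    ∀ k : Fin d → ℕ, (∀ κ, k κ < L) → ∀ ν : Fin d, k ν + 1 < L →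
      ‖(lasso U z k ν : R) - 1‖ ≤
        (ladderLen k ν : ℝ) * (blockGaugeConst K d L * blockGaugeConst K d L * q * lassoConst K d L) := by
  set G := blockGaugeConst K d L with hG
  set Λ := lassoConst K d L with hΛ
  intro k hk ν hν
  suffices H : ∀ N (k : Fin d → ℕ), ladderLen k ν = N → (∀ κ, k κ < L) → k ν + 1 < L →
      ‖(lasso U z k ν : R) - 1‖ ≤ (N : ℝ) * (G * G * q * Λ) from H _ k rfl hk hν
  intro N
  induction N with
  | zero =>
      intro k hN _ _
      rw [lasso_tree U z (isTree_of_ladderLen_eq_zero hN)]; simp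
  | succ N ih =>
      intro k hN hkL hνL
      obtain ⟨ρ₁, hρ₁, hkρ₁⟩ : ∃ ρ ∈ univ.filter (fun ρ : Fin d => (ρ : ℕ) < ν), k ρ ≠ 0 :=
        Finset.exists_ne_zero_of_sum_ne_zero (by unfold ladderLen at hN; omega)
      have h : ∃ ρ, k ρ ≠ 0 := ⟨ρ₁, hkρ₁⟩
      have hν : ((low k h : Fin d) : ℕ) < ν :=
        lt_of_le_of_lt (show ((low k h : Fin d) : ℕ) ≤ ρ₁ from low_le k h hkρ₁) (by simpa using hρ₁)
      have hneν : ν ≠ low k h := by intro h'; rw [← h'] at hν; exact lt_irrefl _ hν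
      have hpL : ∀ κ, pred' k h κ < L := fun κ => (pred'_le k h κ).trans_lt (hkL κ)
      have hpν : pred' k h ν + 1 < L := by rw [pred'_apply_of_ne k h hneν]; exact hνL
      have hN' : ladderLen (pred' k h) ν = N := by have := ladderLen_eq_succ k h hν; omega
      -- the plaquette of the square, at its base point `y = z + pred' k`
      have hstep : ‖(plaq U (site z (pred' k h)) (low k h) ν : R) - 1‖ ≤ q := by
        have hx : site z (pred' k h) + e (low k h) = site z k := by rw [← site_add_single, pred'_add_single]
        apply hq _ _ _ (fun h' => hneν h'.symm)
        · exact (inBlock_site_iff L z _).2 hpL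
        · rw [hx]; exact (inBlock_site_iff L z _).2 hkL
        · rw [← site_add_single]; exact (inBlock_site_iff L z _).2 (lt_of_add_single hpL hpν)
        · rw [hx, ← site_add_single]; exact (inBlock_site_iff L z _).2 (lt_of_add_single hkL hνL)
      -- conjugation cost of the transported plaquette and norm of the running lasso
      have hg : NearUnitary G (hol U z (pred' k h)) := nearUnitary_hol_block hK hU z hpL
      have hP : ‖(hol U z (pred' k h) : R) * (plaq U (site z (pred' k h)) (low k h) ν : R) *
          ↑(hol U z (pred' k h))⁻¹ - 1‖ ≤ G * G * q :=
        (norm_conj_sub_one_le_of_nearUnitary hg _).trans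
          (mul_le_mul_of_nonneg_left hstep (mul_nonneg hg.nonneg hg.nonneg))
      have hW : ‖(lasso U z (pred' k h) ν : R)‖ ≤ Λ := (nearUnitary_lasso hK hU z hpL hpν).1
      have hGq : 0 ≤ G * G * q := mul_nonneg (mul_nonneg hg.nonneg hg.nonneg) hq0
      calc ‖(lasso U z k ν : R) - 1‖
          = ‖(hol U z (pred' k h) : R) * (plaq U (site z (pred' k h)) (low k h) ν : R) *
              ↑(hol U z (pred' k h))⁻¹ * (lasso U z (pred' k h) ν : R) - 1‖ := by
            rw [lasso_rung U z k h ν hν]; simp only [Units.val_mul]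
        _ ≤ ‖(hol U z (pred' k h) : R) * (plaq U (site z (pred' k h)) (low k h) ν : R) *
              ↑(hol U z (pred' k h))⁻¹ - 1‖ * ‖(lasso U z (pred' k h) ν : R)‖ +
              ‖(lasso U z (pred' k h) ν : R) - 1‖ := norm_mul_sub_one_le_telescope _ _
        _ ≤ G * G * q * Λ + (N : ℝ) * (G * G * q * Λ) :=
            add_le_add (mul_le_mul hP hW (norm_nonneg _) hGq) (ih _ hN' hpL hpν)
        _ = ((N + 1 : ℕ) : ℝ) * (G * G * q * Λ) := by push_cast; ring

/-! ## §4  The relative defect through lassos: the window interior bound -/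

/-- [folklore] THE RELATIVE DEFECT IS A CONJUGATE OF THE LASSO RATIO (pure algebra): with `g = hol₀⁻¹·hol₁`,
`(U₁^g)⟨x,x+e_ν⟩·U₀⟨x,x+e_ν⟩⁻¹ = hol₀(k)⁻¹ · (lasso₁(k,ν)·lasso₀(k,ν)⁻¹) · hol₀(k)` for `x = z + k`. -/
theorem defect_eq_conj_lasso (U₀ U₁ : Cfg d R) (z : Site d) (k : Fin d → ℕ) (ν : Fin d) :
    defect U₀ U₁ z (site z k) ν =
      (hol U₀ z k)⁻¹ * (lasso U₁ z k ν * (lasso U₀ z k ν)⁻¹) * hol U₀ z k := by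
  simp only [defect, gaugeAct, lasso, combGauge_site, relGauge, ← site_add_single, mul_inv_rev, inv_inv]
  group

/-- [folklore] THE WINDOW COST `windowCost K d L = (G·G·Λ)·(G·G·Λ)` = `K` to the power `8d(L−1) + 2` — a function of the
block `(d, L)` and the window constant `K` ALONE. -/
def windowCost (K : ℝ) (d L : ℕ) : ℝ :=
  (blockGaugeConst K d L * blockGaugeConst K d L * lassoConst K d L) *
    (blockGaugeConst K d L * blockGaugeConst K d L * lassoConst K d L)

/-- [folklore] The window cost as a single power of `K`: `windowCost K d L = K ^ (8·(d(L−1)) + 2)`. -/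
theorem windowCost_eq_pow (K : ℝ) (d L : ℕ) : windowCost K d L = K ^ (8 * (d * (L - 1)) + 2) := by
  simp only [windowCost, lassoConst, blockGaugeConst]
  ring

/-- [folklore] At `K = 1` there is no cost: `windowCost 1 d L = 1`. -/
theorem windowCost_one (d L : ℕ) : windowCost 1 d L = 1 := by
  simp [windowCost_eq_pow]

/-- [folklore] `windowCost ≥ 1` for `K ≥ 1`. -/
theorem one_le_windowCost {K : ℝ} (hK : 1 ≤ K) (d L : ℕ) : 1 ≤ windowCost K d L := by
  rw [windowCost_eq_pow]; exact one_le_pow₀ hK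

/-- [folklore] THE WINDOW INTERIOR BOUND, NON-ABELIAN, NEAR-UNITARY PAIR — the one-block relative comb gauge bound of
`T4RelativeComb.interior_bound_crude` with the conjugation cost explicit: if `U₀, U₁` are `K`-near-unitary (`K ≥ 1`)
with sup curvature bounds `‖plaq U₁ − 1‖ ≤ q₁`, `‖plaq U₀ − 1‖ ≤ q₀` (`q₁, q₀ ≥ 0`) on the squares of `B(z)`, then on
every interior bond `‖(U₁^g)·U₀⁻¹ − 1‖ ≤ windowCost K d L · (d−1)(L−1) · (q₁ + q₀)`, `windowCost = K^{8d(L−1)+2}`: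
the cost is LOCAL TO THE BLOCK (no dependence on any ambient region), and at `K = 1` it disappears
(`interior_bound_window_one`).  Route: `defect_eq_conj_lasso` (one conjugation, cost `G·G`), `norm_mul_inv_sub_one_le`
(the lasso ratio, cost `Λ`), two window axial counts `norm_lasso_sub_one_le`. -/
theorem interior_bound_window [NormOneClass R] {K : ℝ} (hK : 1 ≤ K) {U₀ U₁ : Cfg d R} {z : Site d} {L : ℕ}
    {q₀ q₁ : ℝ} (hU₀ : ∀ x ν, NearUnitary K (U₀ x ν)) (hU₁ : ∀ x ν, NearUnitary K (U₁ x ν))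
    (hq₁ : PlaqSup L z (fun y ρ ν => ‖(plaq U₁ y ρ ν : R) - 1‖) q₁)
    (hq₀ : PlaqSup L z (fun y ρ ν => ‖(plaq U₀ y ρ ν : R) - 1‖) q₀) (hq₁0 : 0 ≤ q₁) (hq₀0 : 0 ≤ q₀)
    (x : Site d) (ν : Fin d) (hx : InBlock L z x) (hxν : InBlock L z (x + e ν)) :
    ‖(defect U₀ U₁ z x ν : R) - 1‖ ≤ windowCost K d L * (((d : ℝ) - 1) * ((L : ℝ) - 1)) * (q₁ + q₀) := by
  obtain ⟨k, hk, rfl⟩ := exists_offset_of_inBlock hx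
  have hν : k ν + 1 < L := by
    rw [← site_add_single, inBlock_site_iff] at hxν
    simpa using hxν ν
  set G := blockGaugeConst K d L with hG
  set Λ := lassoConst K d L with hΛ
  have hG0 : 0 ≤ G := zero_le_one.trans (one_le_blockGaugeConst hK d L)
  have hΛ0 : 0 ≤ Λ := zero_le_one.trans (one_le_lassoConst hK d L)
  have hN := ladderLen_le hk ν
  have hN0 : 0 ≤ (ladderLen k ν : ℝ) := Nat.cast_nonneg _
  -- the two window axial counts
  have D₁ := norm_lasso_sub_one_le hK hU₁ hq₁ hq₁0 k hk ν hν
  have D₀ := norm_lasso_sub_one_le hK hU₀ hq₀ hq₀0 k hk ν hν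
  -- the lasso ratio
  have hL₀ : NearUnitary Λ (lasso U₀ z k ν) := nearUnitary_lasso hK hU₀ z hk hν
  have hratio : ‖(lasso U₁ z k ν : R) * ↑(lasso U₀ z k ν)⁻¹ - 1‖ ≤
      ((ladderLen k ν : ℝ) * (G * G * q₁ * Λ) + (ladderLen k ν : ℝ) * (G * G * q₀ * Λ)) * Λ :=
    (norm_mul_inv_sub_one_le _ _).trans
      (mul_le_mul (add_le_add D₁ D₀) hL₀.2 (norm_nonneg _) (by positivity))
  -- the outer conjugation by `hol₀(k)⁻¹`
  have hh : NearUnitary G (hol U₀ z k) := nearUnitary_hol_block hK hU₀ z hk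
  calc ‖(defect U₀ U₁ z (site z k) ν : R) - 1‖
      = ‖(((hol U₀ z k)⁻¹ : Rˣ) : R) * ((lasso U₁ z k ν : R) * ↑(lasso U₀ z k ν)⁻¹) * ↑(hol U₀ z k) - 1‖ := by
        rw [defect_eq_conj_lasso]; simp only [Units.val_mul]
    _ ≤ G * G * ‖(lasso U₁ z k ν : R) * ↑(lasso U₀ z k ν)⁻¹ - 1‖ := norm_inv_conj_sub_one_le_of_nearUnitary hh _
    _ ≤ G * G * (((ladderLen k ν : ℝ) * (G * G * q₁ * Λ) + (ladderLen k ν : ℝ) * (G * G * q₀ * Λ)) * Λ) :=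
        mul_le_mul_of_nonneg_left hratio (mul_nonneg hG0 hG0)
    _ = (G * G * Λ) * (G * G * Λ) * (ladderLen k ν : ℝ) * (q₁ + q₀) := by ring
    _ ≤ (G * G * Λ) * (G * G * Λ) * (((d : ℝ) - 1) * ((L : ℝ) - 1)) * (q₁ + q₀) := by
        have h0 : 0 ≤ (G * G * Λ) * (G * G * Λ) := by positivity
        have := mul_le_mul_of_nonneg_left hN h0
        exact mul_le_mul_of_nonneg_right this (add_nonneg hq₁0 hq₀0)
    _ = windowCost K d L * (((d : ℝ) - 1) * ((L : ℝ) - 1)) * (q₁ + q₀) := by rw [windowCost]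

/-- [folklore] CONSISTENCY AT `K = 1`: for unitary-like pairs the window bound IS the unitary count
`(d−1)(L−1)(q₁ + q₀)` of `T4RelativeComb.interior_bound_crude` (same constant; obtained here by the lasso route). -/
theorem interior_bound_window_one [NormOneClass R] {U₀ U₁ : Cfg d R} {z : Site d} {L : ℕ} {q₀ q₁ : ℝ}
    (hU₀ : ∀ x ν, UnitaryLike (U₀ x ν)) (hU₁ : ∀ x ν, UnitaryLike (U₁ x ν))
    (hq₁ : PlaqSup L z (fun y ρ ν => ‖(plaq U₁ y ρ ν : R) - 1‖) q₁)
    (hq₀ : PlaqSup L z (fun y ρ ν => ‖(plaq U₀ y ρ ν : R) - 1‖) q₀) (hq₁0 : 0 ≤ q₁) (hq₀0 : 0 ≤ q₀)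
    (x : Site d) (ν : Fin d) (hx : InBlock L z x) (hxν : InBlock L z (x + e ν)) :
    ‖(defect U₀ U₁ z x ν : R) - 1‖ ≤ ((d : ℝ) - 1) * ((L : ℝ) - 1) * (q₁ + q₀) := by
  have h := interior_bound_window (K := 1) le_rfl
    (fun x ν => NearUnitary.of_unitaryLike (hU₀ x ν) le_rfl)
    (fun x ν => NearUnitary.of_unitaryLike (hU₁ x ν) le_rfl) hq₁ hq₀ hq₁0 hq₀0 x ν hx hxν
  simpa [windowCost_one] using h

/-! ## §5  Non-vacuity -/

/-- The flat pair satisfies every hypothesis of `interior_bound_window` with `K = 1`, `q₀ = q₁ = 0` (over `ℝ`). -/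
example (d L : ℕ) (z x : Site d) (ν : Fin d) (hx : InBlock L z x) (hxν : InBlock L z (x + e ν)) :
    ‖(defect (fun _ _ => (1 : ℝˣ)) (fun _ _ => (1 : ℝˣ)) z x ν : ℝ) - 1‖ ≤
      windowCost 1 d L * (((d : ℝ) - 1) * ((L : ℝ) - 1)) * (0 + 0) :=
  interior_bound_window (K := 1) le_rfl (fun _ _ => NearUnitary.one le_rfl) (fun _ _ => NearUnitary.one le_rfl)
    (by intro y ρ ν _ _ _ _ _; simp [plaq]) (by intro y ρ ν _ _ _ _ _; simp [plaq]) le_rfl le_rfl x ν hx hxν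

/-- Units of norm at most `2` with inverse of norm at most `2` are `2`-near-unitary but need not be unitary-like:
the class is strictly larger than `UnitaryLike` (over `ℝ`, `u = 2`). -/
example : NearUnitary 2 (Units.mk0 (2 : ℝ) two_ne_zero) ∧ ¬ UnitaryLike (Units.mk0 (2 : ℝ) two_ne_zero) := by
  refine ⟨⟨by simp, by simp; norm_num⟩, fun h => ?_⟩
  have h1 : ‖((Units.mk0 (2 : ℝ) two_ne_zero : ℝˣ) : ℝ)‖ = 2 := by simp
  linarith [h.1]

/-! ## §6  (v1.1, append-only) The window dictionary: near-`1` factors times unitary-like factors, and the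
exponential form of the cost -/

/-- [folklore] A unit within `t < 1` of `1` is `(1 − t)⁻¹`-near-unitary: `‖u‖ ≤ 1 + t ≤ (1 − t)⁻¹`, and from the
identity `u⁻¹ = 1 + (1 − u)·u⁻¹` one gets `‖u⁻¹‖ ≤ 1 + t·‖u⁻¹‖`, i.e. `‖u⁻¹‖ ≤ (1 − t)⁻¹` (no completeness of `R` is
needed: `u` is already a unit; this is the a-priori form of the Neumann series bound). -/
theorem NearUnitary.of_norm_sub_one_le [NormOneClass R] {u : Rˣ} {t : ℝ} (hu : ‖(u : R) - 1‖ ≤ t)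
    (ht : t < 1) : NearUnitary (1 - t)⁻¹ u := by
  have h1t : 0 < 1 - t := sub_pos.2 ht
  refine ⟨?_, ?_⟩
  · have h1 : ‖(u : R)‖ ≤ t + 1 := by
      calc ‖(u : R)‖ = ‖((u : R) - 1) + 1‖ := by rw [sub_add_cancel]
        _ ≤ ‖(u : R) - 1‖ + ‖(1 : R)‖ := norm_add_le _ _
        _ ≤ t + 1 := by rw [norm_one]; exact add_le_add hu le_rfl
    have h2 : t + 1 ≤ (1 - t)⁻¹ := by
      rw [← one_div, le_div_iff₀ h1t]; nlinarith [sq_nonneg t]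
    exact h1.trans h2
  · have hid : ((u⁻¹ : Rˣ) : R) = 1 + (1 - (u : R)) * ((u⁻¹ : Rˣ) : R) := by
      rw [sub_mul, one_mul, Units.mul_inv]; abel
    have hv : ‖((u⁻¹ : Rˣ) : R)‖ ≤ 1 + t * ‖((u⁻¹ : Rˣ) : R)‖ := by
      calc ‖((u⁻¹ : Rˣ) : R)‖ = ‖1 + (1 - (u : R)) * ((u⁻¹ : Rˣ) : R)‖ := by rw [← hid]
        _ ≤ ‖(1 : R)‖ + ‖(1 - (u : R))‖ * ‖((u⁻¹ : Rˣ) : R)‖ :=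
            (norm_add_le _ _).trans (add_le_add le_rfl (norm_mul_le _ _))
        _ ≤ 1 + t * ‖((u⁻¹ : Rˣ) : R)‖ := by
            rw [norm_one, norm_sub_rev]
            exact add_le_add le_rfl (mul_le_mul_of_nonneg_right hu (norm_nonneg _))
    rw [show (1 - t)⁻¹ = 1 / (1 - t) from (one_div _).symm, le_div_iff₀ h1t]
    nlinarith [norm_nonneg ((u⁻¹ : Rˣ) : R)]

/-- [folklore] THE COMPLEX-WINDOW DICTIONARY: a bond variable of the form `w·v` with `‖w − 1‖ ≤ t < 1` (a small,
possibly NON-unitary factor — e.g. `w = exp(iB)`, `B` complex small) and `v` unitary-like is `(1 − t)⁻¹`-near-unitary.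
This is how configurations of a complexified window around the 𝔊-valued ones enter `interior_bound_window`. -/
theorem NearUnitary.window [NormOneClass R] {w v : Rˣ} {t : ℝ} (hw : ‖(w : R) - 1‖ ≤ t) (ht : t < 1)
    (hv : UnitaryLike v) : NearUnitary (1 - t)⁻¹ (w * v) := by
  simpa using (NearUnitary.of_norm_sub_one_le hw ht).mul (NearUnitary.of_unitaryLike hv le_rfl)

/-- [folklore] The same with the factors in the other order (`v·w`). -/
theorem NearUnitary.window' [NormOneClass R] {w v : Rˣ} {t : ℝ} (hw : ‖(w : R) - 1‖ ≤ t) (ht : t < 1)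
    (hv : UnitaryLike v) : NearUnitary (1 - t)⁻¹ (v * w) := by
  simpa using (NearUnitary.of_unitaryLike hv le_rfl).mul (NearUnitary.of_norm_sub_one_le hw ht)

/-- [folklore] `1 ≤ (1 − t)⁻¹` for `0 ≤ t < 1`. -/
theorem one_le_inv_one_sub {t : ℝ} (ht0 : 0 ≤ t) (ht : t < 1) : 1 ≤ (1 - t)⁻¹ := by
  have h1t : 0 < 1 - t := sub_pos.2 ht
  rw [← one_div, le_div_iff₀ h1t]; linarith

/-- [folklore] THE WINDOW COST IS `e^{O(d·L·t)}`: for `K = (1 − t)⁻¹`, `0 ≤ t ≤ 1/2`,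
`windowCost K d L ≤ exp((8·d(L−1) + 2)·2t)` — the typed form of "the window must absorb an `e^{O(R·α)}` factor" with
`R` THE BLOCK (`8d(L−1)+2` bonds' worth), not the ambient region. -/
theorem windowCost_le_exp {t : ℝ} (ht0 : 0 ≤ t) (ht : t ≤ 1 / 2) (d L : ℕ) :
    windowCost (1 - t)⁻¹ d L ≤ Real.exp (((8 * (d * (L - 1)) + 2 : ℕ) : ℝ) * (2 * t)) := by
  -- the scalar step `(1 − t)⁻¹ ≤ e^{2t}` for `0 ≤ t ≤ 1/2` (`(1 − t)(1 + 2t) ≥ 1`) is, verbatim, the tree's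
  -- `Literature.NumberTheory.Automorphic.inv_one_sub_le_exp_two_mul`; it is inlined (two lines) rather than imported, to
  -- keep the imports of this leaf inside the Bałaban package.
  have hexp : (1 - t)⁻¹ ≤ Real.exp (2 * t) := by
    have h1t : 0 < 1 - t := by linarith
    have he : 2 * t + 1 ≤ Real.exp (2 * t) := Real.add_one_le_exp (2 * t)
    rw [← one_div, div_le_iff₀ h1t]
    nlinarith [mul_le_mul_of_nonneg_right he h1t.le, mul_nonneg ht0 (by linarith : (0 : ℝ) ≤ 1 - 2 * t)]
  rw [windowCost_eq_pow, Real.exp_nat_mul]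
  exact pow_le_pow_left₀ (inv_nonneg.2 (by linarith)) hexp _

/-- [folklore] THE WINDOW INTERIOR BOUND IN EXPONENTIAL FORM: for `(1 − t)⁻¹`-near-unitary pairs (`0 ≤ t ≤ 1/2`; e.g.
bond variables `w·v`, `‖w − 1‖ ≤ t`, `v` unitary-like, by `NearUnitary.window`) with sup curvature bounds `q₁, q₀ ≥ 0`
on the squares of `B(z)`, every interior bond satisfies
`‖(U₁^g)·U₀⁻¹ − 1‖ ≤ exp((8d(L−1) + 2)·2t) · (d−1)(L−1) · (q₁ + q₀)`. -/
theorem interior_bound_window_exp [NormOneClass R] {t : ℝ} (ht0 : 0 ≤ t) (ht : t ≤ 1 / 2) {U₀ U₁ : Cfg d R}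
    {z : Site d} {L : ℕ} {q₀ q₁ : ℝ} (hU₀ : ∀ x ν, NearUnitary (1 - t)⁻¹ (U₀ x ν))
    (hU₁ : ∀ x ν, NearUnitary (1 - t)⁻¹ (U₁ x ν))
    (hq₁ : PlaqSup L z (fun y ρ ν => ‖(plaq U₁ y ρ ν : R) - 1‖) q₁)
    (hq₀ : PlaqSup L z (fun y ρ ν => ‖(plaq U₀ y ρ ν : R) - 1‖) q₀) (hq₁0 : 0 ≤ q₁) (hq₀0 : 0 ≤ q₀)
    (x : Site d) (ν : Fin d) (hx : InBlock L z x) (hxν : InBlock L z (x + e ν)) :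
    ‖(defect U₀ U₁ z x ν : R) - 1‖ ≤
      Real.exp (((8 * (d * (L - 1)) + 2 : ℕ) : ℝ) * (2 * t)) * (((d : ℝ) - 1) * ((L : ℝ) - 1)) * (q₁ + q₀) := by
  have hK : 1 ≤ (1 - t)⁻¹ := one_le_inv_one_sub ht0 (by linarith)
  have h := interior_bound_window hK hU₀ hU₁ hq₁ hq₀ hq₁0 hq₀0 x ν hx hxν
  obtain ⟨k, hk, rfl⟩ := exists_offset_of_inBlock hx
  have hdl : 0 ≤ ((d : ℝ) - 1) * ((L : ℝ) - 1) := le_trans (Nat.cast_nonneg _) (ladderLen_le hk ν)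
  exact h.trans (mul_le_mul_of_nonneg_right
    (mul_le_mul_of_nonneg_right (windowCost_le_exp ht0 ht d L) hdl) (add_nonneg hq₁0 hq₀0))

/-- [folklore] THE PRINTED ACTION «(𝐔, 𝐉)^u = (u₋𝐔u₊⁻¹, …)» ([Balaban1987RG1] (1.10), CONTEXT) IN THE WINDOW CLASS: a
gauge transformation `g` that is `G`-near-unitary at both endpoints of the bond, acting on a `K`-near-unitary
configuration, gives a `G·K·G`-near-unitary configuration (`T4RelativeComb.gaugeAct g U x ν = g x · U x ν · (g (x + e ν))⁻¹`,
definitionally). -/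
theorem nearUnitary_gaugeAct {G K : ℝ} {g : Site d → Rˣ} {U : Cfg d R} (hg : ∀ x, NearUnitary G (g x))
    (hU : ∀ x ν, NearUnitary K (U x ν)) (x : Site d) (ν : Fin d) :
    NearUnitary (G * K * G) (gaugeAct g U x ν) := by
  show NearUnitary (G * K * G) (g x * U x ν * (g (x + e ν))⁻¹)
  exact ((hg x).mul (hU x ν)).mul (hg (x + e ν)).inv

/-- [folklore] In particular a unitary-like (𝔊-valued) gauge transformation does not change the window constant. -/
theorem nearUnitary_gaugeAct_of_unitaryLike {K : ℝ} {g : Site d → Rˣ} {U : Cfg d R} (hg : ∀ x, UnitaryLike (g x))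
    (hU : ∀ x ν, NearUnitary K (U x ν)) (x : Site d) (ν : Fin d) : NearUnitary K (gaugeAct g U x ν) := by
  simpa using nearUnitary_gaugeAct (fun y => NearUnitary.of_unitaryLike (hg y) le_rfl) hU x ν

/-- Non-vacuity of the dictionary (over `ℝ`): `w = 3/2` is within `t = 1/2` of `1`, so `w·1` is `2`-near-unitary. -/
example : NearUnitary (2 : ℝ) (Units.mk0 (3 / 2 : ℝ) (by norm_num) * 1) := by
  have h := NearUnitary.window (R := ℝ) (t := 1 / 2) (w := Units.mk0 (3 / 2 : ℝ) (by norm_num)) (v := 1)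
    (by simp; norm_num) (by norm_num) T4RelativeLadder.UnitaryLike.one
  have h2 : ((1 : ℝ) - 1 / 2)⁻¹ = 2 := by norm_num
  rw [h2] at h
  simpa using h

/-! ## §7  (v1.2, append-only) THE FACTORISED RESPONSE: gauge the 𝔊-valued parts, carry the complex factors —
the printed mechanism ([Balaban1987RG1] (1.11)–(1.13): `𝐔 = U′U`, CONTEXT) typed with LINEAR constants -/

/-- [folklore] The bondwise product `(W ⊙ U)(b) = W(b)·U(b)` of two configurations — the FACTORISED presentation
`𝐔 = U′U` of [Balaban1987RG1] (1.11)–(1.13) p. 262 (CONTEXT: there `U` is the G-valued part and `U′` the factor near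
`1`; here both are arbitrary unit-valued configurations on `ℤ^d` and the factorisation is DATA). -/
def fmul (W U : Cfg d R) : Cfg d R := fun x ν => W x ν * U x ν

/-- [folklore] -/
@[simp] theorem fmul_apply (W U : Cfg d R) (x : Site d) (ν : Fin d) : fmul W U x ν = W x ν * U x ν := rfl

/-- [folklore] A factorised configuration with `‖W − 1‖ ≤ t < 1` bondwise and `U` unitary-like lies in the
`(1 − t)⁻¹`-window of §1 (§6 `NearUnitary.window`, bondwise): §7 is about a SUB-CLASS of the window class of §4, for
which the cost drops from `windowCost` to linear. -/
theorem nearUnitary_fmul [NormOneClass R] {W U : Cfg d R} {t : ℝ} (hW : ∀ x ν, ‖(W x ν : R) - 1‖ ≤ t) (ht : t < 1)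
    (hU : ∀ x ν, UnitaryLike (U x ν)) (x : Site d) (ν : Fin d) : NearUnitary (1 - t)⁻¹ (fmul W U x ν) :=
  NearUnitary.window (hW x ν) ht (hU x ν)

/-- [folklore] THE FACTORISATION IDENTITY OF THE RESPONSE (pure group algebra, ANY gauge transformation `g`): on the
bond `b = ⟨x, x+e_ν⟩`, `((W₁⊙U₁)^g)(b)·(W₀⊙U₀)(b)⁻¹ = (g_x·W₁(b)·g_x⁻¹)·[(U₁^g)(b)·U₀(b)⁻¹]·W₀(b)⁻¹` — the gauge-fixed
relative bond variable of the factorised pair is (the complex factor of `1`, ROTATED by `g_x`) × (the relative bond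
variable of the 𝔊-valued parts) × (the inverse complex factor of `0`).  Printed shape of the first factor:
«(𝐔)^u = u₋𝐔u₊⁻¹» (1.10) applied to `U′U` gives `(u₋U′u₋⁻¹)·(u₋Uu₊⁻¹)` (CONTEXT). -/
theorem factorised_response (g : Site d → Rˣ) (W₀ U₀ W₁ U₁ : Cfg d R) (x : Site d) (ν : Fin d) :
    gaugeAct g (fmul W₁ U₁) x ν * (fmul W₀ U₀ x ν)⁻¹ =
      (g x * W₁ x ν * (g x)⁻¹) * (gaugeAct g U₁ x ν * (U₀ x ν)⁻¹) * (W₀ x ν)⁻¹ := by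
  show g x * (W₁ x ν * U₁ x ν) * (g (x + e ν))⁻¹ * (W₀ x ν * U₀ x ν)⁻¹ =
    (g x * W₁ x ν * (g x)⁻¹) * (g x * U₁ x ν * (g (x + e ν))⁻¹ * (U₀ x ν)⁻¹) * (W₀ x ν)⁻¹
  simp only [mul_inv_rev]
  group

/-- [folklore] The same in the comb gauge `g = combGauge U₀ U₁ z` OF THE 𝔊-VALUED PARTS: the middle factor is the
unitary transverse defect `T4RelativeComb.defect U₀ U₁ z x ν` (`= 1` on tree bonds, controlled by
`T4RelativeComb.interior_bound_fine` / `_crude` on interior bonds). -/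
theorem factorised_response_comb (W₀ U₀ W₁ U₁ : Cfg d R) (z x : Site d) (ν : Fin d) :
    gaugeAct (combGauge U₀ U₁ z) (fmul W₁ U₁) x ν * (fmul W₀ U₀ x ν)⁻¹ =
      (combGauge U₀ U₁ z x * W₁ x ν * (combGauge U₀ U₁ z x)⁻¹) * defect U₀ U₁ z x ν * (W₀ x ν)⁻¹ := by
  simpa only [defect] using factorised_response (combGauge U₀ U₁ z) W₀ U₀ W₁ U₁ x ν

/-- [folklore] THE LINEAR BOUND OF THE FACTORISED RESPONSE, abstract form: for unitary-like `g`, units `W₁, W₀` and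
any `D`, `‖(g·W₁·g⁻¹)·D·W₀⁻¹ − 1‖ ≤ (‖W₁‖·‖D − 1‖ + ‖W₁ − W₀‖ + 2·‖g − 1‖·‖W₀ − 1‖)·‖W₀⁻¹‖` — from
`(gW₁g⁻¹)DW₀⁻¹ − 1 = ((gW₁g⁻¹)(D − 1) + (gW₁g⁻¹ − W₀))·W₀⁻¹`, `‖gW₁g⁻¹‖ ≤ ‖W₁‖`, and the SECOND-ORDER cross term
`T4RelativeLadder.norm_conj_sub_le` (`‖gW₁g⁻¹ − W₀‖ ≤ ‖W₁ − W₀‖ + 2‖g − 1‖·‖W₀ − 1‖`: relative transport × size of the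
complex factor).  No power of any window constant appears: the conjugator is unitary-like. -/
theorem norm_factorised_sub_one_le {g W₁ W₀ : Rˣ} (hg : UnitaryLike g) (D : R) :
    ‖(g : R) * W₁ * ↑g⁻¹ * D * ↑W₀⁻¹ - 1‖ ≤
      (‖(W₁ : R)‖ * ‖D - 1‖ + ‖(W₁ : R) - W₀‖ + 2 * ‖(g : R) - 1‖ * ‖(W₀ : R) - 1‖) * ‖((W₀⁻¹ : Rˣ) : R)‖ := by
  set A : R := (g : R) * W₁ * ↑g⁻¹ with hA
  have e : A * D * ↑W₀⁻¹ - 1 = (A * (D - 1) + (A - W₀)) * ↑W₀⁻¹ := by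
    calc A * D * ↑W₀⁻¹ - 1 = A * D * ↑W₀⁻¹ - (W₀ : R) * ↑W₀⁻¹ := by rw [Units.mul_inv]
      _ = (A * (D - 1) + (A - W₀)) * ↑W₀⁻¹ := by noncomm_ring
  rw [e]
  have hA1 : ‖A‖ ≤ ‖(W₁ : R)‖ :=
    (T4RelativeLadder.norm_mul_unit_le hg.inv _).trans (T4RelativeLadder.norm_unit_mul_le hg _)
  have hA2 : ‖A - W₀‖ ≤ ‖(W₁ : R) - W₀‖ + 2 * ‖(g : R) - 1‖ * ‖(W₀ : R) - 1‖ :=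
    T4RelativeLadder.norm_conj_sub_le hg _ _
  have hAD : ‖A * (D - 1)‖ ≤ ‖(W₁ : R)‖ * ‖D - 1‖ :=
    (norm_mul_le _ _).trans (mul_le_mul_of_nonneg_right hA1 (norm_nonneg _))
  calc ‖(A * (D - 1) + (A - W₀)) * ↑W₀⁻¹‖ ≤ ‖A * (D - 1) + (A - W₀)‖ * ‖((W₀⁻¹ : Rˣ) : R)‖ := norm_mul_le _ _
    _ ≤ _ := by
        apply mul_le_mul_of_nonneg_right _ (norm_nonneg _)
        calc ‖A * (D - 1) + (A - W₀)‖ ≤ ‖A * (D - 1)‖ + ‖A - W₀‖ := norm_add_le _ _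
          _ ≤ _ := by linarith

/-- [folklore] THE FACTORISED RESPONSE ON A BOND, LINEAR: for factorised pairs `𝐔ᵢ = Wᵢ ⊙ Uᵢ` with unitary-like `Uᵢ`,
in the comb gauge `g = combGauge U₀ U₁ z` of the 𝔊-valued parts, on the bond `b = ⟨x, x+e_ν⟩`:
`‖(𝐔₁^g)(b)·𝐔₀(b)⁻¹ − 1‖ ≤ M·(n₁·δ + w + 2·γ·t₀)` whenever `‖defect(b) − 1‖ ≤ δ` (the unitary relative transverse
defect), `‖g_x − 1‖ ≤ γ` (relative transport; `T4RelativeComb.norm_combGauge_sub_one_le` gives `d(L−1)ε` on the block),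
`‖W₁(b)‖ ≤ n₁`, `‖W₁(b) − W₀(b)‖ ≤ w`, `‖W₀(b) − 1‖ ≤ t₀`, `‖W₀(b)⁻¹‖ ≤ M`.  The gauge is unitary-like
(`T4RelativeComb.unitaryLike_combGauge`): NO conjugation cost, no `windowCost`; the only term beyond the unitary defect
and the complex factors' own relative deviation `w` is the second-order commutator `2γt₀` (the complex factor of `1` is
rotated by `g_x`, that of `0` is not). -/
theorem factorised_bound [NormOneClass R] {U₀ U₁ W₀ W₁ : Cfg d R} {z x : Site d} {ν : Fin d}
    {δ γ n₁ w t₀ M : ℝ} (hU₀ : ∀ x ν, UnitaryLike (U₀ x ν)) (hU₁ : ∀ x ν, UnitaryLike (U₁ x ν))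
    (hδ : ‖(defect U₀ U₁ z x ν : R) - 1‖ ≤ δ) (hγ : ‖(combGauge U₀ U₁ z x : R) - 1‖ ≤ γ)
    (hn₁ : ‖(W₁ x ν : R)‖ ≤ n₁) (hw : ‖(W₁ x ν : R) - W₀ x ν‖ ≤ w) (ht₀ : ‖(W₀ x ν : R) - 1‖ ≤ t₀)
    (hM : ‖(((W₀ x ν)⁻¹ : Rˣ) : R)‖ ≤ M) :
    ‖((gaugeAct (combGauge U₀ U₁ z) (fmul W₁ U₁) x ν * (fmul W₀ U₀ x ν)⁻¹ : Rˣ) : R) - 1‖ ≤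
      M * (n₁ * δ + w + 2 * γ * t₀) := by
  rw [factorised_response_comb]
  push_cast
  have h := norm_factorised_sub_one_le (W₁ := W₁ x ν) (W₀ := W₀ x ν)
    (T4RelativeComb.unitaryLike_combGauge hU₀ hU₁ z x) (defect U₀ U₁ z x ν : R)
  have e1 : ‖(W₁ x ν : R)‖ * ‖(defect U₀ U₁ z x ν : R) - 1‖ ≤ n₁ * δ :=
    mul_le_mul hn₁ hδ (norm_nonneg _) ((norm_nonneg _).trans hn₁)
  have e2 : 2 * ‖(combGauge U₀ U₁ z x : R) - 1‖ * ‖(W₀ x ν : R) - 1‖ ≤ 2 * γ * t₀ := by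
    have := mul_le_mul hγ ht₀ (norm_nonneg _) ((norm_nonneg _).trans hγ)
    linarith
  have hsum : ‖(W₁ x ν : R)‖ * ‖(defect U₀ U₁ z x ν : R) - 1‖ + ‖(W₁ x ν : R) - W₀ x ν‖
      + 2 * ‖(combGauge U₀ U₁ z x : R) - 1‖ * ‖(W₀ x ν : R) - 1‖ ≤ n₁ * δ + w + 2 * γ * t₀ :=
    add_le_add (add_le_add e1 hw) e2
  have h0 : 0 ≤ ‖(W₁ x ν : R)‖ * ‖(defect U₀ U₁ z x ν : R) - 1‖ + ‖(W₁ x ν : R) - W₀ x ν‖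
      + 2 * ‖(combGauge U₀ U₁ z x : R) - 1‖ * ‖(W₀ x ν : R) - 1‖ := by positivity
  calc _ ≤ _ := h
    _ ≤ (n₁ * δ + w + 2 * γ * t₀) * M := mul_le_mul hsum hM (norm_nonneg _) (h0.trans hsum)
    _ = M * (n₁ * δ + w + 2 * γ * t₀) := mul_comm _ _

/-- [folklore] THE FACTORISED RESPONSE ON A BLOCK, packaged with the FINE unitary interior bound: bond deviation `≤ ε`,
raw relative plaquette deviation `≤ p` and base curvature `≤ q` OF THE 𝔊-VALUED PARTS on `B(z)`
(`T4RelativeComb.interior_bound_fine`, `T4RelativeComb.norm_combGauge_sub_one_le`), complex factors with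
`‖W₁‖ ≤ n₁`, `‖W₁ − W₀‖ ≤ w`, `‖W₀ − 1‖ ≤ t₀`, `‖W₀⁻¹‖ ≤ M` on the bonds from block sites, give on every interior bond
`‖(𝐔₁^g)·𝐔₀⁻¹ − 1‖ ≤ M·(n₁·(d−1)(L−1)·(p + 2·d(L−1)ε·q) + w + 2·d(L−1)ε·t₀)` — LINEAR in the block side for the
first-order terms, every cross term second order, no exponential in `d`, `L`. -/
theorem factorised_interior_bound_fine [NormOneClass R] {U₀ U₁ W₀ W₁ : Cfg d R} {z : Site d} {L : ℕ}
    {p q ε n₁ w t₀ M : ℝ} (hU₀ : ∀ x ν, UnitaryLike (U₀ x ν)) (hU₁ : ∀ x ν, UnitaryLike (U₁ x ν)) (hε : 0 ≤ ε)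
    (hdev : ∀ x ν, InBlock L z x → InBlock L z (x + e ν) → ‖(U₁ x ν : R) - U₀ x ν‖ ≤ ε)
    (hp : PlaqSup L z (fun y ρ ν => ‖(plaq U₁ y ρ ν : R) - plaq U₀ y ρ ν‖) p)
    (hq : PlaqSup L z (fun y ρ ν => ‖(plaq U₀ y ρ ν : R) - 1‖) q)
    (hpq : 0 ≤ p + 2 * ((d : ℝ) * ((L : ℝ) - 1) * ε) * q)
    (hn₁ : ∀ x ν, InBlock L z x → ‖(W₁ x ν : R)‖ ≤ n₁)
    (hw : ∀ x ν, InBlock L z x → ‖(W₁ x ν : R) - W₀ x ν‖ ≤ w)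
    (ht₀ : ∀ x ν, InBlock L z x → ‖(W₀ x ν : R) - 1‖ ≤ t₀)
    (hM : ∀ x ν, InBlock L z x → ‖(((W₀ x ν)⁻¹ : Rˣ) : R)‖ ≤ M)
    (x : Site d) (ν : Fin d) (hx : InBlock L z x) (hxν : InBlock L z (x + e ν)) :
    ‖((gaugeAct (combGauge U₀ U₁ z) (fmul W₁ U₁) x ν * (fmul W₀ U₀ x ν)⁻¹ : Rˣ) : R) - 1‖ ≤
      M * (n₁ * (((d : ℝ) - 1) * ((L : ℝ) - 1) * (p + 2 * ((d : ℝ) * ((L : ℝ) - 1) * ε) * q)) + w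
        + 2 * ((d : ℝ) * ((L : ℝ) - 1) * ε) * t₀) :=
  factorised_bound hU₀ hU₁ (T4RelativeComb.interior_bound_fine hU₀ hU₁ hε hdev hp hq hpq x ν hx hxν)
    (T4RelativeComb.norm_combGauge_sub_one_le hU₀ (fun y μ => (hU₁ y μ).1) hε hdev x hx)
    (hn₁ x ν hx) (hw x ν hx) (ht₀ x ν hx) (hM x ν hx)

/-- [folklore] `‖g − 1‖ ≤ 2` for unitary-like `g` (`‖g‖ ≤ 1`, `‖1‖ = 1`): WITHOUT relative transport smallness the
commutator term of `factorised_bound` is only `4·t₀` — first order in the complex factor, not second order. -/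
theorem norm_sub_one_le_two_of_unitaryLike [NormOneClass R] {g : Rˣ} (hg : UnitaryLike g) : ‖(g : R) - 1‖ ≤ 2 := by
  calc ‖(g : R) - 1‖ ≤ ‖(g : R)‖ + ‖(1 : R)‖ := norm_sub_le _ _
    _ ≤ 1 + 1 := add_le_add hg.1 (by rw [norm_one])
    _ = 2 := by norm_num

/-- [folklore] THE FACTORISED RESPONSE with the CRUDE unitary interior bound and NO relative transport smallness:
curvatures `≤ q₁`, `≤ q₀` of the 𝔊-valued parts on `B(z)` give on interior bonds
`‖(𝐔₁^g)·𝐔₀⁻¹ − 1‖ ≤ M·(n₁·(d−1)(L−1)·(q₁ + q₀) + w + 4·t₀)` — still no exponential, but the complex factor of `0`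
now enters at first order (`4t₀`), the honest price of not knowing that the two 𝔊-valued parts are close. -/
theorem factorised_interior_bound_crude [NormOneClass R] {U₀ U₁ W₀ W₁ : Cfg d R} {z : Site d} {L : ℕ}
    {q₀ q₁ n₁ w t₀ M : ℝ} (hU₀ : ∀ x ν, UnitaryLike (U₀ x ν)) (hU₁ : ∀ x ν, UnitaryLike (U₁ x ν))
    (hq₁ : PlaqSup L z (fun y ρ ν => ‖(plaq U₁ y ρ ν : R) - 1‖) q₁)
    (hq₀ : PlaqSup L z (fun y ρ ν => ‖(plaq U₀ y ρ ν : R) - 1‖) q₀) (hq : 0 ≤ q₁ + q₀)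
    (hn₁ : ∀ x ν, InBlock L z x → ‖(W₁ x ν : R)‖ ≤ n₁)
    (hw : ∀ x ν, InBlock L z x → ‖(W₁ x ν : R) - W₀ x ν‖ ≤ w)
    (ht₀ : ∀ x ν, InBlock L z x → ‖(W₀ x ν : R) - 1‖ ≤ t₀)
    (hM : ∀ x ν, InBlock L z x → ‖(((W₀ x ν)⁻¹ : Rˣ) : R)‖ ≤ M)
    (x : Site d) (ν : Fin d) (hx : InBlock L z x) (hxν : InBlock L z (x + e ν)) :
    ‖((gaugeAct (combGauge U₀ U₁ z) (fmul W₁ U₁) x ν * (fmul W₀ U₀ x ν)⁻¹ : Rˣ) : R) - 1‖ ≤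
      M * (n₁ * (((d : ℝ) - 1) * ((L : ℝ) - 1) * (q₁ + q₀)) + w + 4 * t₀) := by
  have h := factorised_bound hU₀ hU₁ (T4RelativeComb.interior_bound_crude hU₀ hU₁ hq₁ hq₀ hq x ν hx hxν)
    (norm_sub_one_le_two_of_unitaryLike (T4RelativeComb.unitaryLike_combGauge hU₀ hU₁ z x))
    (hn₁ x ν hx) (hw x ν hx) (ht₀ x ν hx) (hM x ν hx)
  have e4 : (2 : ℝ) * 2 * t₀ = 4 * t₀ := by ring
  rwa [e4] at h

/-- [folklore] TREE BONDS: the unitary defect is `1` there (`T4RelativeComb.defect_tree`), so the factorised response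
on a tree bond `⟨z+k, z+k+e_ρ⟩` (`IsTree k ρ`) is `(g_x W₁ g_x⁻¹)·W₀⁻¹` and `‖… − 1‖ ≤ M·(w + 2γt₀)`: the comb gauge of
the 𝔊-valued parts does NOT gauge the complex factors' relative deviation away (CONTEXT: ONE complexified configuration
in a generalized axial gauge by a Gᶜ-valued `v`, first order — [Balaban1987RG1] (3.26) p. 275; a complex perturbation
`V′V₀` as the reference of the relative block axial gauges at the price `e^{O(1)(L²α₀+Lα₁)}` — [Balaban1985Averaging]
p. 43, header v1.4 paragraph; GAPS A-t4lit1-3 / -3a / -3b). -/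
theorem factorised_tree_bound [NormOneClass R] {U₀ U₁ W₀ W₁ : Cfg d R} {z : Site d} {k : Fin d → ℕ} {ρ : Fin d}
    (hk : IsTree k ρ) {γ w t₀ M : ℝ} (hU₀ : ∀ x ν, UnitaryLike (U₀ x ν)) (hU₁ : ∀ x ν, UnitaryLike (U₁ x ν))
    (hγ : ‖(combGauge U₀ U₁ z (site z k) : R) - 1‖ ≤ γ)
    (hw : ‖(W₁ (site z k) ρ : R) - W₀ (site z k) ρ‖ ≤ w) (ht₀ : ‖(W₀ (site z k) ρ : R) - 1‖ ≤ t₀)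
    (hM : ‖(((W₀ (site z k) ρ)⁻¹ : Rˣ) : R)‖ ≤ M) :
    ‖((gaugeAct (combGauge U₀ U₁ z) (fmul W₁ U₁) (site z k) ρ * (fmul W₀ U₀ (site z k) ρ)⁻¹ : Rˣ) : R) - 1‖ ≤
      M * (w + 2 * γ * t₀) := by
  have hδ : ‖(defect U₀ U₁ z (site z k) ρ : R) - 1‖ ≤ 0 := by
    rw [defect_tree U₀ U₁ z hk]; simp
  have h := factorised_bound hU₀ hU₁ hδ hγ le_rfl hw ht₀ hM
  simpa using h

/-- [folklore] Sizes of the complex factors from their distance to `1`: `‖W‖ ≤ 1 + t`, `‖W₁ − W₀‖ ≤ t₁ + t₀`, and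
(§6 `NearUnitary.of_norm_sub_one_le`) `‖W⁻¹‖ ≤ (1 − t)⁻¹` for `t < 1`. -/
theorem norm_le_one_add_of_norm_sub_one_le [NormOneClass R] {W : Rˣ} {t : ℝ} (h : ‖(W : R) - 1‖ ≤ t) :
    ‖(W : R)‖ ≤ 1 + t := by
  calc ‖(W : R)‖ = ‖((W : R) - 1) + 1‖ := by rw [sub_add_cancel]
    _ ≤ ‖(W : R) - 1‖ + ‖(1 : R)‖ := norm_add_le _ _
    _ ≤ t + 1 := add_le_add h (by rw [norm_one])
    _ = 1 + t := add_comm _ _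

/-- [folklore] -/
theorem norm_sub_le_of_norm_sub_one_le {W₁ W₀ : Rˣ} {t₁ t₀ : ℝ} (h₁ : ‖(W₁ : R) - 1‖ ≤ t₁)
    (h₀ : ‖(W₀ : R) - 1‖ ≤ t₀) : ‖(W₁ : R) - W₀‖ ≤ t₁ + t₀ := by
  calc ‖(W₁ : R) - W₀‖ = ‖((W₁ : R) - 1) - ((W₀ : R) - 1)‖ := by rw [sub_sub_sub_cancel_right]
    _ ≤ ‖(W₁ : R) - 1‖ + ‖(W₀ : R) - 1‖ := norm_sub_le _ _
    _ ≤ t₁ + t₀ := add_le_add h₁ h₀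

/-- [folklore] THE FACTORISED RESPONSE WITH ABSOLUTE WINDOW DATA ONLY: `‖Wᵢ(b) − 1‖ ≤ tᵢ` (`t₀ < 1`), unitary defect
`≤ δ`, relative transport `≤ γ` give `‖(𝐔₁^g)(b)·𝐔₀(b)⁻¹ − 1‖ ≤ (1 − t₀)⁻¹·((1 + t₁)·δ + (t₁ + t₀) + 2·γ·t₀)` —
to be compared with §4's `windowCost K d L·(d−1)(L−1)·(q₁ + q₀)`, `K = (1 − t)⁻¹`: for pairs PRESENTED FACTORISED the
exponential cost in `d(L−1)` is absent. -/
theorem factorised_bound_abs [NormOneClass R] {U₀ U₁ W₀ W₁ : Cfg d R} {z x : Site d} {ν : Fin d}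
    {δ γ t₁ t₀ : ℝ} (hU₀ : ∀ x ν, UnitaryLike (U₀ x ν)) (hU₁ : ∀ x ν, UnitaryLike (U₁ x ν))
    (hδ : ‖(defect U₀ U₁ z x ν : R) - 1‖ ≤ δ) (hγ : ‖(combGauge U₀ U₁ z x : R) - 1‖ ≤ γ)
    (ht₁ : ‖(W₁ x ν : R) - 1‖ ≤ t₁) (ht₀ : ‖(W₀ x ν : R) - 1‖ ≤ t₀) (ht₀1 : t₀ < 1) :
    ‖((gaugeAct (combGauge U₀ U₁ z) (fmul W₁ U₁) x ν * (fmul W₀ U₀ x ν)⁻¹ : Rˣ) : R) - 1‖ ≤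
      (1 - t₀)⁻¹ * ((1 + t₁) * δ + (t₁ + t₀) + 2 * γ * t₀) :=
  factorised_bound hU₀ hU₁ hδ hγ (norm_le_one_add_of_norm_sub_one_le ht₁) (norm_sub_le_of_norm_sub_one_le ht₁ ht₀)
    ht₀ (NearUnitary.of_norm_sub_one_le ht₀ ht₀1).2

/-- Non-vacuity of §7 (over `ℝ`, `d = 1`): the constant factorised configuration `(3/2) ⊙ 1` lies in the `2`-window
(`nearUnitary_fmul` with `t = 1/2`). -/
example (x : Site 1) (ν : Fin 1) :
    NearUnitary (2 : ℝ) (fmul (fun _ _ => Units.mk0 (3 / 2 : ℝ) (by norm_num)) (fun _ _ => 1) x ν) := by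
  have h := nearUnitary_fmul (R := ℝ) (d := 1) (t := 1 / 2) (W := fun _ _ => Units.mk0 (3 / 2 : ℝ) (by norm_num))
    (U := fun _ _ => 1) (fun _ _ => by simp; norm_num) (by norm_num) (fun _ _ => T4RelativeLadder.UnitaryLike.one) x ν
  have h2 : ((1 : ℝ) - 1 / 2)⁻¹ = 2 := by norm_num
  rwa [h2] at h

/-- Non-vacuity of the abstract bound (over `ℝ`): `g = 1`, `W₁ = 3/2`, `W₀ = 1`, `D = 1` give `‖3/2 − 1‖ ≤ 1/2`. -/
example : ‖((1 : ℝˣ) : ℝ) * ↑(Units.mk0 (3 / 2 : ℝ) (by norm_num)) * ↑(1 : ℝˣ)⁻¹ * (1 : ℝ) * ↑(1 : ℝˣ)⁻¹ - 1‖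
    ≤ 1 / 2 := by
  have h := norm_factorised_sub_one_le (R := ℝ) (W₁ := Units.mk0 (3 / 2 : ℝ) (by norm_num)) (W₀ := 1)
    T4RelativeLadder.UnitaryLike.one (1 : ℝ)
  refine h.trans ?_
  simp
  norm_num

end Literature.MathematicalPhysics.QuantumFieldTheory.Balaban1983to89.T4RelativeCombWindow
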